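import Summits.SmoothPoincare4.SmoothPoincare4.Theorems.SullivanDualHyperbolicEndTaubesModelDefs

/-!
# Route `SullivanDual`, crux `HyperbolicEnd` (stmt-SmoothPoincare4-7825), line `taubes-circle-pencil`:
# the Pfaffian of Taubes' model form `ωT` and its zero locus

Registered helpers `helper_taubesForm_pfaffian` and `helper_taubesForm_eq_zero_iff` of the checked
skeleton, about the explicit formula `taubesForm` (`= ωT = dt ∧ dQ + ⋆₃ dQ`) of
`Theorems/SullivanDualHyperbolicEndTaubesModelDefs.lean` on a flat Taubes tube `taubesTube δ`,
`0 < δ < 1` (Taubes, Geom. Topol. 2 (1998), §1):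

* `helper_taubesForm_pfaffian` — the PFAFFIAN of `ωT` in the flat basis `eᵢ = EuclideanSpace.single i 1`:
  `ω₀₁ ω₂₃ − ω₀₂ ω₁₃ + ω₀₃ ω₁₂ = −((r − 1)² + y₂² + 4 y₃²)/r`, `r = taubesR y = √(y₀² + y₁²) > 0`;
  equivalently `ωT ∧ ωT = 2 (a² + b² + 4c²) dt∧da∧db∧dc = −(2/r)(a² + b² + 4c²) dy₀∧dy₁∧dy₂∧dy₃`
  (the toroidal frame `(∂_t, ∂_a, e₂, e₃)` is NEGATIVELY oriented in `ℝ⁴`): `ωT` is non-degenerate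
  exactly off the core circle, with the orientation opposite to `dy₀₁₂₃` — Taubes tubes are
  orientation-reversing immersions;
* `helper_taubesForm_eq_zero_iff` — the ZERO LOCUS: `ωT_y = 0` (as a bilinear form on `ℝ⁴`) iff
  `y ∈ taubesCore = {y₀² + y₁² = 1, y₂ = y₃ = 0}`.

Method.  On the tube `r > 0` (`δ < 1` keeps the tube off the axis `y₀ = y₁ = 0`).  The toroidal
components of the basis vectors are `dt(e₀) = −y₁/r²`, `dt(e₁) = y₀/r²`, `dt(e₂) = dt(e₃) = 0`,
`da(e₀) = y₀/r`, `da(e₁) = y₁/r`, `da(e₂) = da(e₃) = 0` (`PiLp.single_apply`); unfolding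
`taubesForm`/`taubesDQ` the six values `ω_ij` are rational in `(y, r)`, and the difference of the two
sides of the Pfaffian identity equals `((r − 1)² + y₂² + 4y₃²)(r² − y₀² − y₁²)/r³` as a rational
function (`field_simp` + `ring`), which vanishes by `r² = y₀² + y₁²` (`Real.sq_sqrt`).  For the zero
locus: on the core `r = 1`, `y₂ = y₃ = 0`, so `dQ = 0` and every term of `ωT` carries a factor
`r − 1`, `y₂` or `y₃`; conversely if `ωT_y = 0` the Pfaffian's left side vanishes, so
`(r − 1)² + y₂² + 4y₃² = 0`, i.e. `r = 1`, `y₂ = y₃ = 0`, i.e. `y₀² + y₁² = r² = 1`.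
-/

-- the registered namespace `Summit.SmoothPoincare4.SmoothPoincare4.…` repeats a component (P = Sub)
set_option linter.dupNamespace false

noncomputable section

namespace Summit.SmoothPoincare4.SmoothPoincare4.Cruxes.HyperbolicEnd.TaubesCirclePencil

/-! ### Positivity off the axis and the radius identity -/

/-- On a tube of radius `< 1` the distance from the axis is positive (private copy of the sibling
identities file's lemma). [folklore] -/
private theorem pfaffian_taubesR_pos (δ : ℝ) (y : EuclideanSpace ℝ (Fin 4)) (hδ0 : 0 < δ)
    (hδ : δ < 1) (hy : y ∈ taubesTube δ) : 0 < taubesR y := by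
  rw [mem_taubesTube] at hy
  by_contra h
  have h0 : taubesR y = 0 := le_antisymm (not_lt.mp h) (Real.sqrt_nonneg _)
  have h1 : (1 : ℝ) ≤ (taubesR y - 1) ^ 2 + y 2 ^ 2 + y 3 ^ 2 := by
    rw [h0]; nlinarith [sq_nonneg (y 2), sq_nonneg (y 3)]
  nlinarith [hδ0, hδ, h1, hy]

/-- `r² = y₀² + y₁²`. [folklore] -/
private theorem pfaffian_taubesR_sq (y : EuclideanSpace ℝ (Fin 4)) :
    taubesR y ^ 2 = y 0 ^ 2 + y 1 ^ 2 :=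
  Real.sq_sqrt (add_nonneg (sq_nonneg _) (sq_nonneg _))

/-! ### Toroidal components of the flat basis vectors -/

/-- Components of the flat basis vectors `eᵢ = EuclideanSpace.single i 1`. [folklore] -/
private theorem pfaffian_single_apply (i j : Fin 4) :
    (EuclideanSpace.single i (1 : ℝ) : EuclideanSpace ℝ (Fin 4)) j = if j = i then 1 else 0 := by
  simp

/-- `dt(e₀) = −y₁/r²`. [folklore] -/
private theorem pfaffian_dt0 (y : EuclideanSpace ℝ (Fin 4)) :
    taubesDt y (EuclideanSpace.single 0 1) = -(y 1) / taubesR y ^ 2 := by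
  simp [taubesDt]

/-- `dt(e₁) = y₀/r²`. [folklore] -/
private theorem pfaffian_dt1 (y : EuclideanSpace ℝ (Fin 4)) :
    taubesDt y (EuclideanSpace.single 1 1) = y 0 / taubesR y ^ 2 := by
  simp [taubesDt]

/-- `dt(e₂) = 0`. [folklore] -/
private theorem pfaffian_dt2 (y : EuclideanSpace ℝ (Fin 4)) :
    taubesDt y (EuclideanSpace.single 2 1) = 0 := by
  simp [taubesDt]

/-- `dt(e₃) = 0`. [folklore] -/
private theorem pfaffian_dt3 (y : EuclideanSpace ℝ (Fin 4)) :
    taubesDt y (EuclideanSpace.single 3 1) = 0 := by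
  simp [taubesDt]

/-- `da(e₀) = y₀/r`. [folklore] -/
private theorem pfaffian_da0 (y : EuclideanSpace ℝ (Fin 4)) :
    taubesDa y (EuclideanSpace.single 0 1) = y 0 / taubesR y := by
  simp [taubesDa]

/-- `da(e₁) = y₁/r`. [folklore] -/
private theorem pfaffian_da1 (y : EuclideanSpace ℝ (Fin 4)) :
    taubesDa y (EuclideanSpace.single 1 1) = y 1 / taubesR y := by
  simp [taubesDa]

/-- `da(e₂) = 0`. [folklore] -/
private theorem pfaffian_da2 (y : EuclideanSpace ℝ (Fin 4)) :
    taubesDa y (EuclideanSpace.single 2 1) = 0 := by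
  simp [taubesDa]

/-- `da(e₃) = 0`. [folklore] -/
private theorem pfaffian_da3 (y : EuclideanSpace ℝ (Fin 4)) :
    taubesDa y (EuclideanSpace.single 3 1) = 0 := by
  simp [taubesDa]

/-! ### The Pfaffian -/

/-- **The Pfaffian of Taubes' model form** in the flat basis `eᵢ = EuclideanSpace.single i 1`:
`ω₀₁ ω₂₃ − ω₀₂ ω₁₃ + ω₀₃ ω₁₂ = −((r − 1)² + y₂² + 4y₃²)/r` on the tube (`r = taubesR y > 0`), i.e.
`ωT ∧ ωT = −(2/r)(a² + b² + 4c²) dy₀∧dy₁∧dy₂∧dy₃`: `ωT` is non-degenerate exactly off the core circle,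
with the orientation opposite to the flat one (Taubes 1998, §1: `ωT ∧ ωT = 2|∇Q|² dt∧da∧db∧dc`, and
the toroidal frame is negatively oriented). [folklore] -/
theorem helper_taubesForm_pfaffian : ∀ (δ : ℝ) (y : EuclideanSpace ℝ (Fin 4)), 0 < δ → δ < 1 → y ∈ taubesTube δ → taubesForm y (EuclideanSpace.single 0 1) (EuclideanSpace.single 1 1) * taubesForm y (EuclideanSpace.single 2 1) (EuclideanSpace.single 3 1) - taubesForm y (EuclideanSpace.single 0 1) (EuclideanSpace.single 2 1) * taubesForm y (EuclideanSpace.single 1 1) (EuclideanSpace.single 3 1) + taubesForm y (EuclideanSpace.single 0 1) (EuclideanSpace.single 3 1) * taubesForm y (EuclideanSpace.single 1 1) (EuclideanSpace.single 2 1) = -((taubesR y - 1) ^ 2 + y 2 ^ 2 + 4 * y 3 ^ 2) / taubesR y := by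
  intro δ y hδ0 hδ hy
  have hr := pfaffian_taubesR_pos δ y hδ0 hδ hy
  have hr0 : taubesR y ≠ 0 := hr.ne'
  have hsq := pfaffian_taubesR_sq y
  -- the identity holds as a rational identity in `(y, r)` modulo `r² = y₀² + y₁²`
  have key :
      taubesForm y (EuclideanSpace.single 0 1) (EuclideanSpace.single 1 1)
            * taubesForm y (EuclideanSpace.single 2 1) (EuclideanSpace.single 3 1)
          - taubesForm y (EuclideanSpace.single 0 1) (EuclideanSpace.single 2 1)
            * taubesForm y (EuclideanSpace.single 1 1) (EuclideanSpace.single 3 1)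
          + taubesForm y (EuclideanSpace.single 0 1) (EuclideanSpace.single 3 1)
            * taubesForm y (EuclideanSpace.single 1 1) (EuclideanSpace.single 2 1)
        - -((taubesR y - 1) ^ 2 + y 2 ^ 2 + 4 * y 3 ^ 2) / taubesR y =
      ((taubesR y - 1) ^ 2 + y 2 ^ 2 + 4 * y 3 ^ 2) / taubesR y ^ 3
        * (taubesR y ^ 2 - (y 0 ^ 2 + y 1 ^ 2)) := by
    simp only [taubesForm, taubesDQ, pfaffian_dt0, pfaffian_dt1, pfaffian_dt2, pfaffian_dt3,
      pfaffian_da0, pfaffian_da1, pfaffian_da2, pfaffian_da3, pfaffian_single_apply]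
    simp only [Fin.isValue, Fin.reduceEq, if_true, if_false, mul_zero, zero_mul, mul_one,
      sub_zero, zero_sub, add_zero, zero_add]
    field_simp
    ring
  linear_combination key + ((taubesR y - 1) ^ 2 + y 2 ^ 2 + 4 * y 3 ^ 2) / taubesR y ^ 3 * hsq

/-! ### The zero locus -/

/-- **The zero locus of Taubes' model form is the core circle**: for `y` in the tube, `ωT_y = 0` as a
bilinear form on `ℝ⁴` iff `y ∈ taubesCore = {y₀² + y₁² = 1, y₂ = y₃ = 0}` (Taubes 1998, §1: `ωT`
vanishes exactly, and transversally, along the zero circle; `⇒` by the Pfaffian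
`−((r − 1)² + y₂² + 4y₃²)/r` of `helper_taubesForm_pfaffian`). [folklore] -/
theorem helper_taubesForm_eq_zero_iff : ∀ (δ : ℝ) (y : EuclideanSpace ℝ (Fin 4)), 0 < δ → δ < 1 → y ∈ taubesTube δ → ((∀ u v : EuclideanSpace ℝ (Fin 4), taubesForm y u v = 0) ↔ y ∈ taubesCore) := by
  intro δ y hδ0 hδ hy
  have hr := pfaffian_taubesR_pos δ y hδ0 hδ hy
  have hsq := pfaffian_taubesR_sq y
  constructor
  · intro h
    have hP := helper_taubesForm_pfaffian δ y hδ0 hδ hy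
    simp only [h, mul_zero, sub_zero, add_zero] at hP
    have hP' : -((taubesR y - 1) ^ 2 + y 2 ^ 2 + 4 * y 3 ^ 2) / taubesR y = 0 := hP.symm
    rw [div_eq_zero_iff, neg_eq_zero] at hP'
    rcases hP' with hS | hr0
    · have ha2 : (taubesR y - 1) ^ 2 = 0 := by
        linarith [sq_nonneg (taubesR y - 1), sq_nonneg (y 2), sq_nonneg (y 3)]
      have hb2 : y 2 ^ 2 = 0 := by
        linarith [sq_nonneg (taubesR y - 1), sq_nonneg (y 2), sq_nonneg (y 3)]
      have hc2 : y 3 ^ 2 = 0 := by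
        linarith [sq_nonneg (taubesR y - 1), sq_nonneg (y 2), sq_nonneg (y 3)]
      have ha : taubesR y = 1 := by
        have := (pow_eq_zero_iff (n := 2) two_ne_zero).mp ha2
        linarith
      rw [mem_taubesCore]
      refine ⟨?_, (pow_eq_zero_iff (n := 2) two_ne_zero).mp hb2,
        (pow_eq_zero_iff (n := 2) two_ne_zero).mp hc2⟩
      rw [← hsq, ha, one_pow]
    · exact absurd hr0 hr.ne'
  · intro hc u v
    rw [mem_taubesCore] at hc
    obtain ⟨h01, h2, h3⟩ := hc
    have hr1 : taubesR y = 1 := by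
      rw [taubesR, h01, Real.sqrt_one]
    simp [taubesForm, taubesDQ, hr1, h2, h3]

end Summit.SmoothPoincare4.SmoothPoincare4.Cruxes.HyperbolicEnd.TaubesCirclePencil

end
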